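/-
Copyright (c) 2026 the pub-hodgecm-mathlib formalisation cell (harness21).  Prover seat hodgecm-mathlib-A-p16 (g32): road «S3-ram» (LEAD F0P3a-plan (g12 → g13); owner∕table
F0P3a-p06 (g15)), the (a2) JUNCTION (J★) of F0P3a-p01 (g17) — organ «(J★) HEAD modulo the CONFIGURATION COUNTS» (A-p16 (g32), p01 «=» 01:50:26Z (3)), FILE 1 of 2:
the ROOT LINE COUNTS of a `J₀`-literal in CHART currency (lattice `ν`-sets ↦ ★ RootTwists ∕ RootClassSplit filters); 2026-09-02.
-/
import Literature.NumberTheory.Automorphic.UnitaryLatticeTreeResidualDatumRamified          -- ★ G3⁵ (F0P2-p06 (g13)): brings ★ G3⁗ `ncard_neighborSet_root_pred_eq_natCard`, `exists_unit_v_sub_mul_sq_lt_one_iff_residue`, `residue_map_sigma_eq`, `residue_eq_zero_iff_v_lt_one`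
import Literature.NumberTheory.Automorphic.UnitaryLatticeTreeRootGrandchildLabelsRamified      -- ★ ROW-ROOT-LBL p847534 (F0P3a-p04 (g19)): `coe_inv_mul_sub_one_mul_eq_conj_diagonal`, `pairing_coe_mulVec_single_eq_inv_mul_mul_apply`
import Literature.NumberTheory.Automorphic.UnitaryLatticeTreeIsTreeDiagonalRamified          -- ★ J1 p847380 (F0P2-p02 (g13)): `ringChar_residueField_ne_two`
import Literature.NumberTheory.Rogawski1990.DepthZeroKappaTransferTypeOneRamifiedRootLineCounts -- ★ ROW-ROOT-CNT p847528 (F0P2-p02 (g13)): §3 `natCard_nullParams_conj_frame_eq_card_filter`, §4 `card_sub_one_mul_natCard_params_quadraticChar_eq_card_filter`, `quadraticChar_mul_mul_self_mul`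
import HarnessLib

/-!
# The ramified type-(1) `κ`-orbital integral: the ROOT LINE COUNTS of a `J₀`-literal `γ = A·diag(s)·A⁻¹` in CHART currency — the junction engine's lattice `ν`-sets are
# ★ RootTwists' ∕ ★ RootClassSplit's residual counts (Rogawski 1990 §4.9 Prop. 4.9.1 (b); Kottwitz 1986 §3; Bruhat–Tits 1972 §10)

Topic `NumberTheory/Rogawski1990`; namespace `Literature.NumberTheory.Rogawski1990`.  THEOREMS ONLY (no definition, no instance, no notation, no named fact, no `sorry`); kernel
lane `--supports stmt-HodgeConjecture-24833`; datum-free over the abstract lattice model (`K` with `Valued K ℤᵐ⁰`, `σ` valuation-preserving and residually trivial, `σϖ = −ϖ`,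
finite residue field of characteristic `≠ 2`).  Cell `pub/hodgecm-mathlib` (D-0151), crux H413; road «S3-ram» (Literature seeding, count-neutral), fold of record v7.7 socket (J★)
:164; junction pen F0P3a-p01 (g17), J-PACK v2 (03ef5f1f), skeleton v4∕…∕v7.  ORGAN «(J★) HEAD modulo the CONFIGURATION COUNTS» (A-p16 (g32); p01 «=» 01:50:26Z (3); ref5 R-356),
FILE 1: the pen's engine theorem `strataCount_J₀_equilateral` (v4 :486 ≡ v7) expresses the five strata counts of one literal in the `J₀`-model through THREE ROOT LINE COUNTS
`νE νP νM` — `ncard`s of sets of CHILDREN `κ·N₁` of the root (`κ ∈ U(J₀) ∩ GL₃(𝒪)`) keyed by the depth-`N` value `(ϖ^N)⁻¹·B₀(κe₀, (γ−1)κe₀)` of their line (NULL, resp. of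
class `c·(unit)²`) — and the head's signed sum over the four literals needs these counts in the RESIDUAL CHART currency of ★ RootTwists `signedSum_card_rootNull_twists` ∕ ★
RootClassSplit `signedSum_card_rootClass_twists`.  THIS FILE is that dictionary for a literal given in an integral eigenframe, `γ = A·diag(s)·A⁻¹` with `A, A⁻¹` integral,
`diag d = (−det diag d)·ᵗσ(A) J₀ A` (`|dᵢ| = 1`), `s₁ = 1`, common depth `sᵢ − 1 = tᵢϖ^N` (the EQUILATERAL configuration; `t₂` a unit):

* §1 `exists_residualFrame`: the residue `B̄ = Ā ∈ GL₃(𝓀)` with `ᵗB̄ J₀ B̄ = c̄⁻¹·diag(d̄)`, `c̄ = −Πd̄ᵢ ≠ 0` (reduce the frame identity; `σ̄ = id` by ★ `residue_map_sigma_eq`).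
* §2 `conj_diagonal_sub_one_eq_smul`, `exists_leadingMatrix`: `γ − 1 = ϖ^N·Y`, `Y = A·diag(t)·A⁻¹` integral with residue `Ȳ = B̄·diag(t̄)·B̄⁻¹`.
* §3 `exists_integer_pairing_mulVec` (line values `B₀(κe₀, Yκe₀) = (κ⁻¹Yκ)₂₀` are integral), `inv_pow_mul_pairing_sub_one_eq`, and the residual forms of the two line predicates:
  `v_lt_one_iff_exists_residue_eq_zero` (NULL) and `exists_unit_class_iff_exists_residue` (CLASS `c`: `χ(c̄⁻¹·x̄) = 1`, via ★ `exists_unit_v_sub_mul_sq_lt_one_iff_residue` and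
  `exists_ne_zero_eq_mul_sq_iff_quadraticChar`).
* §4 **`ncard_rootNullLines_eq_card_filter`** (`νE`-set VERBATIM = `#{(a,b) : d̄₀ + d̄₁a² + d̄₂b² = 0 ∧ d̄₀t̄₀ + d̄₂t̄₂b² = 0}`) and
  **`card_sub_one_mul_ncard_rootClassLines_eq_card_filter`** (`(q−1)·νP`-set VERBATIM for any unit class constant `cst = c₀` = `#{v ∈ 𝓀³ : Σd̄ᵢvᵢ² = 0 ∧ χ((c̄₀⁻¹c̄⁻¹)(d̄₀t̄₀v₀² + d̄₂t̄₂v₂²)) = 1}`),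
  by ★ G3⁗ `ncard_neighborSet_root_pred_eq_natCard` ∘ §1–§3 ∘ ★ ROW-ROOT-CNT §3∕§4; plus `card_filter_quadraticChar_mul_eq_one_eq_of_eq_neg_one` (a non-square twist of the
  constant flips `χ = 1` to `χ = −1`: the `νM` class `−(c₁ε)`).
FILE 2 (`…SignedCountOfStrataCounts`) sums these over the four literals `d_b = (ε^b₁u₀, ε^b₂u₁, ε^(b₁+b₂)u₂)` with the signs `(−1)^b₂`.
HONEST LABEL: HC_CM is proved only modulo the 2 remaining named inputs (hLiu418 24832, h413 24833) until rung 0 closes; nothing printed is asserted here (lattice ∕ residue bookkeeping).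

## References
* [Rogawski1990] J. D. Rogawski, *Automorphic Representations of Unitary Groups in Three Variables*, Ann. of Math. Stud. 123 (1990), §4.9 Prop. 4.9.1 (b) p. 55 (root line counts).
* [Kottwitz1986] R. E. Kottwitz, *Base change for unit elements of Hecke algebras*, Compositio Math. 60 (1986), §3 (counting fixed lattices in an eigenbasis, residually).
* [BruhatTits1972] F. Bruhat, J. Tits, *Groupes réductifs sur un corps local I*, Publ. Math. IHÉS 41 (1972), §10 (the star of the root = the residual conic).
* [IrelandRosen1990] K. Ireland, M. Rosen, *A Classical Introduction to Modern Number Theory*, GTM 84, Ch. 8 §1–§2 (the quadratic character; counting with `χ`).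
-/

set_option autoImplicit false

noncomputable section

open scoped Valued WithZero Matrix MatrixGroups
open Polynomial Finset
open Literature.NumberTheory.Automorphic Literature.NumberTheory.Automorphic.HermitianLattice Literature.NumberTheory.Automorphic.UnitaryLatticeTree

namespace Literature.NumberTheory.Rogawski1990

variable {K : Type*} [Field K] [Valued K ℤᵐ⁰] {σ : K →+* K} {ϖ : K}

/-! ## §1 The residual frame `B̄ = Ā ∈ GL₃(𝓀)` of an integral frame `A` of a diagonal unit form: `ᵗB̄ J₀ B̄ = c̄⁻¹·diag(d̄)` -/

/-- Injectivity of the entrywise inclusion `M₃(𝒪) → M₃(K)`. [folklore] -/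
private theorem map_subtype_injective :
    Function.Injective (fun M : Matrix (Fin 3) (Fin 3) 𝒪[K] => M.map (Valued.integer K).subtype) :=
  fun _ _ h => Matrix.map_injective Subtype.val_injective h

/-- **THE RESIDUAL FRAME.**  For an integral frame `A ∈ GL₃(K)` (`A`, `A⁻¹` integral) of a diagonal unit form, `diag d = (−det diag d)·ᵗσ(A) J₀ A` with `|dᵢ| = 1`
(`dᵢ = d₀ᵢ ∈ 𝒪`), and `σ` residually trivial: the residue `B̄ = Ā ∈ GL₃(𝓀)` satisfies `ᵗB̄ J₀ B̄ = c̄⁻¹ · diag(d̄)` with `c̄ = −Π d̄ᵢ ≠ 0` (the residue of `−det diag d`).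
[cite: Kottwitz1986, §3] [cite: BruhatTits1972, §10] [cite: Rogawski1990, §4.9 p. 55] -/
theorem exists_residualFrame (hvσ : ∀ a, Valued.v (σ a) = Valued.v a) (hres : ∀ x : K, Valued.v x ≤ 1 → Valued.v (σ x - x) < 1)
    (d : Fin 3 → K) (d₀ : Fin 3 → 𝒪[K]) (hd₀ : ∀ i, (d₀ i : K) = d i) (hd : ∀ i, Valued.v (d i) = 1)
    (A : GL (Fin 3) K) (hA : IsIntMatrix (A : Matrix (Fin 3) (Fin 3) K)) (hA' : IsIntMatrix ((A⁻¹ : GL (Fin 3) K) : Matrix (Fin 3) (Fin 3) K))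
    (hdA : Matrix.diagonal d = (-(Matrix.diagonal d).det) • formCongr σ A ((StdForm.antidiagonal 3).over K)) :
    ∃ (A₀ A₀' : Matrix (Fin 3) (Fin 3) 𝒪[K]) (B : GL (Fin 3) 𝓀[K]),
      (∀ i j, (A₀ i j : K) = (A : Matrix (Fin 3) (Fin 3) K) i j) ∧ (∀ i j, (A₀' i j : K) = ((A⁻¹ : GL (Fin 3) K) : Matrix (Fin 3) (Fin 3) K) i j) ∧
      A₀ * A₀' = 1 ∧ A₀' * A₀ = 1 ∧
      (B : Matrix (Fin 3) (Fin 3) 𝓀[K]) = A₀.map (IsLocalRing.residue 𝒪[K]) ∧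
      ((B⁻¹ : GL (Fin 3) 𝓀[K]) : Matrix (Fin 3) (Fin 3) 𝓀[K]) = A₀'.map (IsLocalRing.residue 𝒪[K]) ∧
      IsLocalRing.residue 𝒪[K] (-∏ i, d₀ i) ≠ 0 ∧
      (B : Matrix (Fin 3) (Fin 3) 𝓀[K])ᵀ * ((StdForm.antidiagonal 3).over 𝓀[K]) * (B : Matrix (Fin 3) (Fin 3) 𝓀[K]) =
        (IsLocalRing.residue 𝒪[K] (-∏ i, d₀ i))⁻¹ • Matrix.diagonal (fun i => IsLocalRing.residue 𝒪[K] (d₀ i)) := by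
  have hσO : ∀ x : 𝒪[K], σ x ∈ 𝒪[K] := map_coe_mem_integer hvσ
  let A₀ : Matrix (Fin 3) (Fin 3) 𝒪[K] := fun i j => ⟨(A : Matrix (Fin 3) (Fin 3) K) i j, (Valuation.mem_integer_iff _ _).2 (hA i j)⟩
  let A₀' : Matrix (Fin 3) (Fin 3) 𝒪[K] := fun i j => ⟨((A⁻¹ : GL (Fin 3) K) : Matrix (Fin 3) (Fin 3) K) i j, (Valuation.mem_integer_iff _ _).2 (hA' i j)⟩
  let Aσ : Matrix (Fin 3) (Fin 3) 𝒪[K] := fun i j => ⟨σ ((A : Matrix (Fin 3) (Fin 3) K) i j), hσO (A₀ i j)⟩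
  have hcoe : A₀.map (Valued.integer K).subtype = (A : Matrix (Fin 3) (Fin 3) K) := by ext i j; rfl
  have hcoe' : A₀'.map (Valued.integer K).subtype = ((A⁻¹ : GL (Fin 3) K) : Matrix (Fin 3) (Fin 3) K) := by ext i j; rfl
  have hcoeσ : Aσ.map (Valued.integer K).subtype = (A : Matrix (Fin 3) (Fin 3) K).map σ := by ext i j; rfl
  have hJ : ((StdForm.antidiagonal 3).over 𝒪[K]).map (Valued.integer K).subtype = (StdForm.antidiagonal 3).over K := StdForm.over_map _ _
  have hmul : A₀ * A₀' = 1 := map_subtype_injective (by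
    change (A₀ * A₀').map _ = (1 : Matrix (Fin 3) (Fin 3) 𝒪[K]).map _
    rw [Matrix.map_mul, hcoe, hcoe', ← Units.val_mul, mul_inv_cancel, Units.val_one, Matrix.map_one _ (map_zero _) (map_one _)])
  have hmul' : A₀' * A₀ = 1 := map_subtype_injective (by
    change (A₀' * A₀).map _ = (1 : Matrix (Fin 3) (Fin 3) 𝒪[K]).map _
    rw [Matrix.map_mul, hcoe, hcoe', ← Units.val_mul, inv_mul_cancel, Units.val_one, Matrix.map_one _ (map_zero _) (map_one _)])
  -- the residues
  have hred : (A₀ * A₀').map (IsLocalRing.residue 𝒪[K]) = 1 := by rw [hmul, Matrix.map_one _ (map_zero _) (map_one _)]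
  have hred' : (A₀' * A₀).map (IsLocalRing.residue 𝒪[K]) = 1 := by rw [hmul', Matrix.map_one _ (map_zero _) (map_one _)]
  rw [Matrix.map_mul] at hred hred'
  let B : GL (Fin 3) 𝓀[K] := ⟨A₀.map (IsLocalRing.residue 𝒪[K]), A₀'.map (IsLocalRing.residue 𝒪[K]), hred, hred'⟩
  have hAσ : Aσ.map (IsLocalRing.residue 𝒪[K]) = A₀.map (IsLocalRing.residue 𝒪[K]) := by
    ext i j
    exact residue_map_sigma_eq hvσ hres (A₀ i j)
  -- `c̄ ≠ 0`
  have hdres : ∀ i, IsLocalRing.residue 𝒪[K] (d₀ i) ≠ 0 := fun i h => by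
    rw [residue_eq_zero_iff_v_lt_one, hd₀, hd] at h
    exact lt_irrefl _ h
  have hc : IsLocalRing.residue 𝒪[K] (-∏ i, d₀ i) ≠ 0 := by
    rw [map_neg, map_prod, neg_ne_zero]
    exact Finset.prod_ne_zero_iff.2 fun i _ => hdres i
  -- the frame identity over `𝒪`
  have hO : Matrix.diagonal d₀ = (-∏ i, d₀ i) • (Aσᵀ * ((StdForm.antidiagonal 3).over 𝒪[K]) * A₀) := map_subtype_injective (by
    change (Matrix.diagonal d₀).map _ = ((-∏ i, d₀ i) • (Aσᵀ * ((StdForm.antidiagonal 3).over 𝒪[K]) * A₀)).map _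
    rw [Matrix.map_smul' _ _ _ (fun a b => rfl), Matrix.map_mul, Matrix.map_mul, Matrix.transpose_map, hcoeσ, hJ, hcoe,
      Matrix.diagonal_map (map_zero _)]
    have h1 : (fun m => (Valued.integer K).subtype (d₀ m)) = d := funext fun i => hd₀ i
    have h2 : (Valued.integer K).subtype (-∏ i, d₀ i) = -(Matrix.diagonal d).det := by
      rw [map_neg, map_prod, Matrix.det_diagonal]
      exact congrArg Neg.neg (Finset.prod_congr rfl fun i _ => hd₀ i)
    rw [h1, h2]
    exact hdA)
  -- reduce modulo `𝔪`
  have hk : Matrix.diagonal (fun i => IsLocalRing.residue 𝒪[K] (d₀ i)) =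
      IsLocalRing.residue 𝒪[K] (-∏ i, d₀ i) • ((A₀.map (IsLocalRing.residue 𝒪[K]))ᵀ * ((StdForm.antidiagonal 3).over 𝓀[K]) * A₀.map (IsLocalRing.residue 𝒪[K])) := by
    have h : (Matrix.diagonal d₀).map (IsLocalRing.residue 𝒪[K]) = ((-∏ i, d₀ i) • (Aσᵀ * ((StdForm.antidiagonal 3).over 𝒪[K]) * A₀)).map (IsLocalRing.residue 𝒪[K]) := by
      rw [← hO]
    rw [Matrix.diagonal_map (map_zero _), Matrix.map_smul' _ _ _ (fun a b => map_mul _ a b), Matrix.map_mul, Matrix.map_mul, Matrix.transpose_map, hAσ,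
      StdForm.over_map] at h
    exact h
  refine ⟨A₀, A₀', B, fun i j => rfl, fun i j => rfl, hmul, hmul', rfl, rfl, hc, ?_⟩
  change (A₀.map (IsLocalRing.residue 𝒪[K]))ᵀ * ((StdForm.antidiagonal 3).over 𝓀[K]) * A₀.map (IsLocalRing.residue 𝒪[K]) = _
  rw [hk, smul_smul, inv_mul_cancel₀ hc, one_smul]

/-! ## §2 The residual leading matrix `Ȳ = B̄·diag(t̄)·B̄⁻¹` of `γ = A·diag(s)·A⁻¹` at a common depth `N` (`sᵢ − 1 = tᵢ·ϖ^N`) -/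

omit [Valued K ℤᵐ⁰] in
/-- `γ − 1 = ϖ^N · (A·diag(t)·A⁻¹)` when `γ = A·diag(s)·A⁻¹` and `sᵢ − 1 = tᵢ ϖ^N`. [cite: Kottwitz1986, §3] -/
theorem conj_diagonal_sub_one_eq_smul (A : GL (Fin 3) K) (s : Fin 3 → K) {γm : Matrix (Fin 3) (Fin 3) K}
    (hγA : γm = (A : Matrix (Fin 3) (Fin 3) K) * Matrix.diagonal s * ((A⁻¹ : GL (Fin 3) K) : Matrix (Fin 3) (Fin 3) K))
    {N : ℕ} (t : Fin 3 → K) (ht : ∀ i, s i - 1 = t i * ϖ ^ N) :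
    γm - 1 = (ϖ ^ N) • ((A : Matrix (Fin 3) (Fin 3) K) * Matrix.diagonal t * ((A⁻¹ : GL (Fin 3) K) : Matrix (Fin 3) (Fin 3) K)) := by
  have h := coe_inv_mul_sub_one_mul_eq_conj_diagonal A 1 s hγA
  rw [mul_one, inv_one, Units.val_one, Matrix.one_mul, Matrix.mul_one, inv_inv] at h
  have hdiag : Matrix.diagonal (fun i => s i - 1) = (ϖ ^ N) • Matrix.diagonal t := by
    rw [← Matrix.diagonal_smul]
    congr 1
    funext i
    rw [ht i, Pi.smul_apply, smul_eq_mul, mul_comm]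
  rw [h, hdiag, Matrix.mul_smul, Matrix.smul_mul]

/-- **THE RESIDUAL LEADING MATRIX**: with `A₀, A₀'` the integral matrices of `A, A⁻¹` and `tᵢ ∈ 𝒪`, the matrix `Y₀ := A₀·diag(t)·A₀'` over `𝒪` is the integral leading term
`(ϖ^N)⁻¹(γ − 1)` and its residue is `Ā·diag(t̄)·Ā′`. [cite: Kottwitz1986, §3] [cite: Rogawski1990, §4.9 p. 55] -/
theorem exists_leadingMatrix (hϖ : Valued.v ϖ = WithZero.exp (-1 : ℤ)) (A : GL (Fin 3) K) (A₀ A₀' : Matrix (Fin 3) (Fin 3) 𝒪[K])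
    (hA₀ : ∀ i j, (A₀ i j : K) = (A : Matrix (Fin 3) (Fin 3) K) i j) (hA₀' : ∀ i j, (A₀' i j : K) = ((A⁻¹ : GL (Fin 3) K) : Matrix (Fin 3) (Fin 3) K) i j)
    (s : Fin 3 → K) {γm : Matrix (Fin 3) (Fin 3) K}
    (hγA : γm = (A : Matrix (Fin 3) (Fin 3) K) * Matrix.diagonal s * ((A⁻¹ : GL (Fin 3) K) : Matrix (Fin 3) (Fin 3) K))
    {N : ℕ} (t : Fin 3 → 𝒪[K]) (ht : ∀ i, s i - 1 = (t i : K) * ϖ ^ N) :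
    ∃ Y₀ : Matrix (Fin 3) (Fin 3) 𝒪[K], (∀ i j, ((Y₀ i j : 𝒪[K]) : K) = (ϖ ^ N)⁻¹ * (γm - 1) i j) ∧
      (Y₀.map (Valued.integer K).subtype = (A : Matrix (Fin 3) (Fin 3) K) * Matrix.diagonal (fun i => (t i : K)) * ((A⁻¹ : GL (Fin 3) K) : Matrix (Fin 3) (Fin 3) K)) ∧
      Y₀.map (IsLocalRing.residue 𝒪[K]) =
        A₀.map (IsLocalRing.residue 𝒪[K]) * Matrix.diagonal (fun i => IsLocalRing.residue 𝒪[K] (t i)) * A₀'.map (IsLocalRing.residue 𝒪[K]) := by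
  have hϖ0 : ϖ ≠ 0 := fun h0 => by rw [h0, map_zero] at hϖ; exact WithZero.coe_ne_zero hϖ.symm
  have hcoe : A₀.map (Valued.integer K).subtype = (A : Matrix (Fin 3) (Fin 3) K) := by ext i j; exact hA₀ i j
  have hcoe' : A₀'.map (Valued.integer K).subtype = ((A⁻¹ : GL (Fin 3) K) : Matrix (Fin 3) (Fin 3) K) := by ext i j; exact hA₀' i j
  have hY : (A₀ * Matrix.diagonal t * A₀').map (Valued.integer K).subtype =
      (A : Matrix (Fin 3) (Fin 3) K) * Matrix.diagonal (fun i => (t i : K)) * ((A⁻¹ : GL (Fin 3) K) : Matrix (Fin 3) (Fin 3) K) := by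
    rw [Matrix.map_mul, Matrix.map_mul, hcoe, hcoe', Matrix.diagonal_map (map_zero _)]
    rfl
  refine ⟨A₀ * Matrix.diagonal t * A₀', fun i j => ?_, hY, ?_⟩
  · have h1 : (((A₀ * Matrix.diagonal t * A₀') i j : 𝒪[K]) : K) = ((A₀ * Matrix.diagonal t * A₀').map (Valued.integer K).subtype) i j := rfl
    rw [h1, hY, conj_diagonal_sub_one_eq_smul A s hγA (fun i => (t i : K)) ht, Matrix.smul_apply, smul_eq_mul, inv_mul_cancel_left₀ (pow_ne_zero _ hϖ0)]
  · rw [Matrix.map_mul, Matrix.map_mul, Matrix.diagonal_map (map_zero _)]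

/-! ## §3 Line values at the root: integrality, and the `E` ∕ class predicates in residual form -/

/-- **INTEGRALITY OF THE DEPTH-`N` LINE VALUE**: for `κ ∈ U(J₀) ∩ GL₃(𝒪)` and an integral `Y`, the value `B₀(κe₀, Y κe₀) = (κ⁻¹Yκ)₂₀` is integral. [cite: Kottwitz1986, §3] -/
theorem exists_integer_pairing_mulVec (κ : unitaryGroupOfForm σ ((StdForm.antidiagonal 3).over K)) (hκ : κ ∈ unitaryInt σ ((StdForm.antidiagonal 3).over K))
    {Y : Matrix (Fin 3) (Fin 3) K} (hY : IsIntMatrix Y) :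
    ∃ t₀ : 𝒪[K], (t₀ : K) = pairing σ ((StdForm.antidiagonal 3).over K) (((κ : GL (Fin 3) K) : Matrix (Fin 3) (Fin 3) K) *ᵥ Pi.single 0 1)
        (Y *ᵥ (((κ : GL (Fin 3) K) : Matrix (Fin 3) (Fin 3) K) *ᵥ Pi.single 0 1)) := by
  rw [pairing_coe_mulVec_single_eq_inv_mul_mul_apply κ Y]
  obtain ⟨hκ1, hκ2⟩ := mem_unitaryInt_iff.1 hκ
  have hint : IsIntMatrix ((((κ : GL (Fin 3) K)⁻¹ : GL (Fin 3) K) : Matrix (Fin 3) (Fin 3) K) * Y * ((κ : GL (Fin 3) K) : Matrix (Fin 3) (Fin 3) K)) :=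
    isIntMatrix_mul (isIntMatrix_mul hκ2 hY) hκ1
  exact ⟨⟨_, (Valuation.mem_integer_iff _ _).2 (hint 2 0)⟩, rfl⟩

omit [Valued K ℤᵐ⁰] in
/-- The depth-`N` value of the line `κe₀` under `γ − 1 = ϖ^N·Y` is the value under `Y`: `(ϖ^N)⁻¹·B₀(κe₀, (γ−1)κe₀) = B₀(κe₀, Yκe₀)`. [cite: Kottwitz1986, §3] -/
theorem inv_pow_mul_pairing_sub_one_eq (hϖ0 : ϖ ≠ 0) {γm Y : Matrix (Fin 3) (Fin 3) K} {N : ℕ} (hY : γm - 1 = (ϖ ^ N) • Y) (x : Fin 3 → K) :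
    (ϖ ^ N)⁻¹ * pairing σ ((StdForm.antidiagonal 3).over K) x ((γm - 1) *ᵥ x) = pairing σ ((StdForm.antidiagonal 3).over K) x (Y *ᵥ x) := by
  rw [hY, Matrix.smul_mulVec, map_smul, smul_eq_mul, inv_mul_cancel_left₀ (pow_ne_zero _ hϖ0)]

/-- `|x| < 1` for an INTEGRAL `x`, in residual form. [cite: Kottwitz1986, §3] -/
theorem v_lt_one_iff_exists_residue_eq_zero {x : K} (t₀ : 𝒪[K]) (ht₀ : (t₀ : K) = x) :
    Valued.v x < 1 ↔ ∃ t : 𝒪[K], (t : K) = x ∧ IsLocalRing.residue 𝒪[K] t = 0 := by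
  constructor
  · intro h
    refine ⟨t₀, ht₀, (residue_eq_zero_iff_v_lt_one t₀).2 ?_⟩
    rwa [ht₀]
  · rintro ⟨t, ht, h0⟩
    rw [← ht]
    exact (residue_eq_zero_iff_v_lt_one t).1 h0

omit [Valued K ℤᵐ⁰] in
/-- `t ∈ s·(k×)²` iff `χ(s⁻¹t) = 1` (`s ≠ 0`, finite field of odd or even characteristic alike: `χ(0) = 0`). [cite: IrelandRosen1990, Ch. 8 §1] -/
theorem exists_ne_zero_eq_mul_sq_iff_quadraticChar {k : Type*} [Field k] [Fintype k] [DecidableEq k] {s t : k} (hs : s ≠ 0) :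
    (∃ a : k, a ≠ 0 ∧ t = s * a ^ 2) ↔ quadraticChar k (s⁻¹ * t) = 1 := by
  constructor
  · rintro ⟨a, ha, rfl⟩
    rw [← mul_assoc, inv_mul_cancel₀ hs, one_mul]
    exact quadraticChar_sq_one' ha
  · intro h
    have hne : s⁻¹ * t ≠ 0 := fun h0 => by rw [h0, MulChar.map_zero] at h; exact zero_ne_one h
    obtain ⟨a, ha⟩ := (quadraticChar_one_iff_isSquare hne).1 h
    refine ⟨a, fun ha0 => hne (by rw [ha, ha0, mul_zero]), ?_⟩
    rw [pow_two, ← ha, ← mul_assoc, mul_inv_cancel₀ hs, one_mul]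

/-- The CLASS predicate «`x ≡ c·a²` for a unit `a`» for an INTEGRAL `x` and a unit constant `c = c₀ ∈ 𝒪`, in residual form: `χ(c̄⁻¹·x̄) = 1`. [cite: Rogawski1990, §4.9 p. 55]
[cite: IrelandRosen1990, Ch. 8 §1] -/
theorem exists_unit_class_iff_exists_residue [Fintype 𝓀[K]] [DecidableEq 𝓀[K]] {x : K} (t₀ : 𝒪[K]) (ht₀ : (t₀ : K) = x)
    {c : K} (c₀ : 𝒪[K]) (hc₀ : (c₀ : K) = c) (hc : Valued.v c = 1) :
    (∃ a : K, Valued.v a = 1 ∧ Valued.v (x - c * a ^ 2) < 1) ↔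
      ∃ t : 𝒪[K], (t : K) = x ∧ quadraticChar 𝓀[K] ((IsLocalRing.residue 𝒪[K] c₀)⁻¹ * IsLocalRing.residue 𝒪[K] t) = 1 := by
  have hc0 : IsLocalRing.residue 𝒪[K] c₀ ≠ 0 := fun h => by
    rw [residue_eq_zero_iff_v_lt_one, hc₀, hc] at h
    exact lt_irrefl _ h
  rw [← ht₀, ← hc₀, exists_unit_v_sub_mul_sq_lt_one_iff_residue t₀ c₀, exists_ne_zero_eq_mul_sq_iff_quadraticChar hc0]
  constructor
  · exact fun h => ⟨t₀, rfl, h⟩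
  · rintro ⟨t, ht, h⟩
    rwa [Subtype.ext ht] at h

/-! ## §4 The root line counts of a `J₀`-literal in CHART currency (equal depths `sᵢ − 1 = tᵢϖ^N`: the equilateral configuration) -/

set_option maxHeartbeats 800000 in
/-- **THE NULL ROOT LINES OF THE `J₀`-LITERAL `γ = A·diag(s)·A⁻¹` = ★ RootTwists' CHART COUNT.**  The junction engine's `νE` (skeleton v4 :486 `hνE` set VERBATIM: children
`κ·N₁` of the root, `κ ∈ U(J₀) ∩ GL₃(𝒪)`, whose depth-`N` line value `(ϖ^N)⁻¹·B₀(κe₀, (γ−1)κe₀)` is residually NULL) equals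
`#{(a,b) ∈ 𝓀² : d̄₀ + d̄₁a² + d̄₂b² = 0 ∧ d̄₀t̄₀ + d̄₂t̄₂b² = 0}` for the residues `d̄ᵢ` of the diagonal unit form framed by `A` and `t̄ᵢ` of the leading coefficients
(`sᵢ − 1 = tᵢϖ^N`, `s₁ = 1`, `t₂` a unit).  Chain: ★ G3⁗ `ncard_neighborSet_root_pred_eq_natCard` (`P = (· = 0)`) ∘ §2 (`Ȳ = B̄·diag(t̄)·B̄⁻¹`) ∘ §1 (`ᵗB̄J₀B̄ = c̄⁻¹diag(d̄)`)
∘ ★ ROW-ROOT-CNT `natCard_nullParams_conj_frame_eq_card_filter`. [cite: Rogawski1990, §4.9 Prop. 4.9.1 (b) p. 55] [cite: Kottwitz1986, §3] [cite: BruhatTits1972, §10] -/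
theorem ncard_rootNullLines_eq_card_filter (hσ : ∀ x, σ (σ x) = x) (hvσ : ∀ a, Valued.v (σ a) = Valued.v a) (hσϖ : σ ϖ = -ϖ)
    (hϖ : Valued.v ϖ = WithZero.exp (-1 : ℤ)) (hres : ∀ x : K, Valued.v x ≤ 1 → Valued.v (σ x - x) < 1) (h2 : Valued.v (2 : K) = 1)
    [Fintype 𝓀[K]] [DecidableEq 𝓀[K]]
    {γ : unitaryGroupOfForm σ ((StdForm.antidiagonal 3).over K)}
    (d : Fin 3 → K) (d₀ : Fin 3 → 𝒪[K]) (hd₀ : ∀ i, (d₀ i : K) = d i) (hd : ∀ i, Valued.v (d i) = 1)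
    (A : GL (Fin 3) K) (hA : IsIntMatrix (A : Matrix (Fin 3) (Fin 3) K)) (hA' : IsIntMatrix ((A⁻¹ : GL (Fin 3) K) : Matrix (Fin 3) (Fin 3) K))
    (hdA : Matrix.diagonal d = (-(Matrix.diagonal d).det) • formCongr σ A ((StdForm.antidiagonal 3).over K))
    (s : Fin 3 → K) (hs1 : s 1 = 1)
    (hγA : ((γ : GL (Fin 3) K) : Matrix (Fin 3) (Fin 3) K) = (A : Matrix (Fin 3) (Fin 3) K) * Matrix.diagonal s * ((A⁻¹ : GL (Fin 3) K) : Matrix (Fin 3) (Fin 3) K))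
    {N : ℕ} (t : Fin 3 → 𝒪[K]) (ht : ∀ i, s i - 1 = (t i : K) * ϖ ^ N)
    (ht2 : Valued.v (t 2 : K) = 1) :
    ({c : {M : Submodule 𝒪[K] (Fin 3 → K) // IsVertex σ ϖ ((StdForm.antidiagonal 3).over K) M} | (latticeGraph σ ϖ ((StdForm.antidiagonal 3).over K)).Adj ⟨stdLattice K 3, 0, isSelfDualLattice_stdLattice_three_of_v hϖ⟩ c ∧ ∃ κ : unitaryGroupOfForm σ ((StdForm.antidiagonal 3).over K), κ ∈ unitaryInt σ ((StdForm.antidiagonal 3).over K) ∧ c = latticeGraphIso σ ϖ ((StdForm.antidiagonal 3).over K) κ ⟨latt (Matrix.diagonal ![(1 : K), 1, ϖ]), 2, isVertexLattice_two_N₁_of_neg hσϖ hϖ⟩ ∧ (Valued.v ((ϖ ^ N)⁻¹ * pairing σ ((StdForm.antidiagonal 3).over K) (((κ : GL (Fin 3) K) : Matrix (Fin 3) (Fin 3) K) *ᵥ Pi.single 0 1) ((((γ : GL (Fin 3) K) : Matrix (Fin 3) (Fin 3) K) - 1) *ᵥ (((κ : GL (Fin 3) K) : Matrix (Fin 3)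 (Fin 3) K) *ᵥ Pi.single 0 1))) < 1)}).ncard =
      (univ.filter fun q : 𝓀[K] × 𝓀[K] =>
        IsLocalRing.residue 𝒪[K] (d₀ 0) + IsLocalRing.residue 𝒪[K] (d₀ 1) * q.1 ^ 2 + IsLocalRing.residue 𝒪[K] (d₀ 2) * q.2 ^ 2 = 0 ∧
          IsLocalRing.residue 𝒪[K] (d₀ 0) * IsLocalRing.residue 𝒪[K] (t 0) + IsLocalRing.residue 𝒪[K] (d₀ 2) * IsLocalRing.residue 𝒪[K] (t 2) * q.2 ^ 2 = 0).card := by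
  have hϖ0 : ϖ ≠ 0 := fun h0 => by rw [h0, map_zero] at hϖ; exact WithZero.coe_ne_zero hϖ.symm
  obtain ⟨A₀, A₀', B, hA₀, hA₀', -, -, hB, hB', hc, hframe⟩ := exists_residualFrame hvσ hres d d₀ hd₀ hd A hA hA' hdA
  obtain ⟨Y₀, hY₀, hYK, hYres⟩ := exists_leadingMatrix hϖ A A₀ A₀' hA₀ hA₀' s hγA t ht
  have hYint : IsIntMatrix (Y₀.map (Valued.integer K).subtype) := fun i j => (Valuation.mem_integer_iff _ _).1 (Y₀ i j).2
  have hsub : (((γ : GL (Fin 3) K) : Matrix (Fin 3) (Fin 3) K) - 1) = (ϖ ^ N) • Y₀.map (Valued.integer K).subtype := by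
    rw [hYK]; exact conj_diagonal_sub_one_eq_smul A s hγA _ ht
  have hset : {c : {M : Submodule 𝒪[K] (Fin 3 → K) // IsVertex σ ϖ ((StdForm.antidiagonal 3).over K) M} | (latticeGraph σ ϖ ((StdForm.antidiagonal 3).over K)).Adj ⟨stdLattice K 3, 0, isSelfDualLattice_stdLattice_three_of_v hϖ⟩ c ∧ ∃ κ : unitaryGroupOfForm σ ((StdForm.antidiagonal 3).over K), κ ∈ unitaryInt σ ((StdForm.antidiagonal 3).over K) ∧ c = latticeGraphIso σ ϖ ((StdForm.antidiagonal 3).over K) κ ⟨latt (Matrix.diagonal ![(1 : K), 1, ϖ]), 2, isVertexLattice_two_N₁_of_neg hσϖ hϖ⟩ ∧ (Valued.v ((ϖ ^ N)⁻¹ * pairing σ ((StdForm.antidiagonal 3).over K) (((κ : GL (Fin 3) K) : Matrix (Fin 3) (Fin 3) K) *ᵥ Pi.single 0 1) ((((γ : GL (Fin 3) K) : Matrix (Fin 3) (Fin 3) K) - 1) *ᵥ (((κ : GL (Fin 3) K) : Matrix (Fin 3) (Fin 3) K) *ᵥ Pi.single 0 1))) < 1)} =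
      {w | w ∈ (latticeGraph σ ϖ ((StdForm.antidiagonal 3).over K)).neighborSet ⟨stdLattice K 3, 0, isSelfDualLattice_stdLattice_three_of_v hϖ⟩ ∧
        ∃ κ : unitaryGroupOfForm σ ((StdForm.antidiagonal 3).over K), κ ∈ unitaryInt σ ((StdForm.antidiagonal 3).over K) ∧
          w.1 = mapGL (κ : GL (Fin 3) K) (latt (Matrix.diagonal ![(1 : K), 1, ϖ])) ∧
          ∃ t : 𝒪[K], ((t : K) = (ϖ ^ N)⁻¹ * B₀ σ 3 (((κ : GL (Fin 3) K) : Matrix (Fin 3) (Fin 3) K) *ᵥ (Pi.single 0 1))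
              ((((γ : GL (Fin 3) K) : Matrix (Fin 3) (Fin 3) K) - 1) *ᵥ (((κ : GL (Fin 3) K) : Matrix (Fin 3) (Fin 3) K) *ᵥ (Pi.single 0 1)))) ∧ IsLocalRing.residue 𝒪[K] t = 0} := by
    ext w
    simp only [Set.mem_setOf_eq, SimpleGraph.mem_neighborSet]
    refine and_congr_right fun _ => exists_congr fun κ => and_congr_right fun hκ => and_congr ⟨fun h => h ▸ rfl, fun h => Subtype.ext h⟩ ?_
    obtain ⟨t₀, ht₀⟩ := exists_integer_pairing_mulVec κ hκ hYint
    rw [← pairing_antidiagonal σ, inv_pow_mul_pairing_sub_one_eq hϖ0 hsub]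
    exact v_lt_one_iff_exists_residue_eq_zero t₀ ht₀
  rw [hset, ncard_neighborSet_root_pred_eq_natCard hσ hvσ hσϖ hϖ hres h2 _ Y₀ hY₀ (fun x => x = 0)
    (fun c u hc => by rw [mul_eq_zero, mul_eq_zero, or_self, or_iff_right hc]), hYres, ← hB, ← hB']
  have hdres : ∀ i, IsLocalRing.residue 𝒪[K] (d₀ i) ≠ 0 := fun i h => by
    rw [residue_eq_zero_iff_v_lt_one, hd₀, hd] at h
    exact lt_irrefl _ h
  have ht1 : IsLocalRing.residue 𝒪[K] (t 1) = 0 := by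
    have h1 : (t 1 : K) = 0 := by
      have h := ht 1
      rw [hs1, sub_self] at h
      exact (mul_eq_zero.1 h.symm).resolve_right (pow_ne_zero _ hϖ0)
    have h1' : t 1 = 0 := Subtype.ext h1
    rw [h1', map_zero]
  have ht2' : IsLocalRing.residue 𝒪[K] (t 2) ≠ 0 := fun h => by
    rw [residue_eq_zero_iff_v_lt_one, ht2] at h
    exact lt_irrefl _ h
  exact natCard_nullParams_conj_frame_eq_card_filter (ringChar_residueField_ne_two h2) B (inv_ne_zero hc) hframe (hdres 1) (hdres 2)
    (s := fun i => IsLocalRing.residue 𝒪[K] (t i)) ht1 ht2'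

set_option maxHeartbeats 800000 in
/-- **THE CLASS-`c` ROOT LINES OF THE `J₀`-LITERAL, TIMES `q − 1`, = ★ RootClassSplit's VECTOR COUNT.**  The junction engine's `νP` ∕ `νM` sets (skeleton v4 :486 `hνP`∕`hνM`
VERBATIM, class constant `cst` = the engine's `−c₁` resp. `−(c₁ε)`, a unit `cst = c₀ ∈ 𝒪`): `(q − 1)·#{children κ·N₁ : depth-N line value ≡ c·a², |a| = 1}` equals
`#{v ∈ 𝓀³ : d̄₀v₀² + d̄₁v₁² + d̄₂v₂² = 0 ∧ χ((c̄₀⁻¹c̄⁻¹)·(d̄₀t̄₀v₀² + d̄₂t̄₂v₂²)) = 1}` with `c̄ = −Πd̄ᵢ` the residue of `−det diag d`.  Chain: ★ G3⁗ (`P = (χ(c̄₀⁻¹·) = 1)`,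
square-invariant) ∘ §2 ∘ §1 ∘ ★ ROW-ROOT-CNT `card_sub_one_mul_natCard_params_quadraticChar_eq_card_filter`. [cite: Rogawski1990, §4.9 Prop. 4.9.1 (b) p. 55] [cite: Kottwitz1986, §3]
[cite: IrelandRosen1990, Ch. 8 §2] -/
theorem card_sub_one_mul_ncard_rootClassLines_eq_card_filter (hσ : ∀ x, σ (σ x) = x) (hvσ : ∀ a, Valued.v (σ a) = Valued.v a) (hσϖ : σ ϖ = -ϖ)
    (hϖ : Valued.v ϖ = WithZero.exp (-1 : ℤ)) (hres : ∀ x : K, Valued.v x ≤ 1 → Valued.v (σ x - x) < 1) (h2 : Valued.v (2 : K) = 1)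
    [Fintype 𝓀[K]] [DecidableEq 𝓀[K]]
    {γ : unitaryGroupOfForm σ ((StdForm.antidiagonal 3).over K)}
    (d : Fin 3 → K) (d₀ : Fin 3 → 𝒪[K]) (hd₀ : ∀ i, (d₀ i : K) = d i) (hd : ∀ i, Valued.v (d i) = 1)
    (A : GL (Fin 3) K) (hA : IsIntMatrix (A : Matrix (Fin 3) (Fin 3) K)) (hA' : IsIntMatrix ((A⁻¹ : GL (Fin 3) K) : Matrix (Fin 3) (Fin 3) K))
    (hdA : Matrix.diagonal d = (-(Matrix.diagonal d).det) • formCongr σ A ((StdForm.antidiagonal 3).over K))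
    (s : Fin 3 → K) (hs1 : s 1 = 1)
    (hγA : ((γ : GL (Fin 3) K) : Matrix (Fin 3) (Fin 3) K) = (A : Matrix (Fin 3) (Fin 3) K) * Matrix.diagonal s * ((A⁻¹ : GL (Fin 3) K) : Matrix (Fin 3) (Fin 3) K))
    {N : ℕ} (t : Fin 3 → 𝒪[K]) (ht : ∀ i, s i - 1 = (t i : K) * ϖ ^ N)
    (cst : K) (c₀ : 𝒪[K]) (hc₀ : (c₀ : K) = cst) (hc : Valued.v cst = 1) :
    (Nat.card 𝓀[K] - 1) * ({c : {M : Submodule 𝒪[K] (Fin 3 → K) // IsVertex σ ϖ ((StdForm.antidiagonal 3).over K) M} | (latticeGraph σ ϖ ((StdForm.antidiagonal 3).over K)).Adj ⟨stdLattice K 3, 0, isSelfDualLattice_stdLattice_three_of_v hϖ⟩ c ∧ ∃ κ : unitaryGroupOfForm σ ((StdForm.antidiagonal 3).over K), κ ∈ unitaryInt σ ((StdForm.antidiagonal 3).over K) ∧ c = latticeGraphIso σ ϖ ((StdForm.antidiagonal 3).over K) κ ⟨latt (Matrix.diagonal ![(1 : K), 1, ϖ]), 2, isVertexLattice_two_N₁_of_neg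 hσϖ hϖ⟩ ∧ (∃ a : K, Valued.v a = 1 ∧ Valued.v (((ϖ ^ N)⁻¹ * pairing σ ((StdForm.antidiagonal 3).over K) (((κ : GL (Fin 3) K) : Matrix (Fin 3) (Fin 3) K) *ᵥ Pi.single 0 1) ((((γ : GL (Fin 3) K) : Matrix (Fin 3) (Fin 3) K) - 1) *ᵥ (((κ : GL (Fin 3) K) : Matrix (Fin 3) (Fin 3) K) *ᵥ Pi.single 0 1))) - cst * a ^ 2) < 1)}).ncard =
      (univ.filter fun v : 𝓀[K] × 𝓀[K] × 𝓀[K] =>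
        IsLocalRing.residue 𝒪[K] (d₀ 0) * v.1 ^ 2 + IsLocalRing.residue 𝒪[K] (d₀ 1) * v.2.1 ^ 2 + IsLocalRing.residue 𝒪[K] (d₀ 2) * v.2.2 ^ 2 = 0 ∧
          quadraticChar 𝓀[K] (((IsLocalRing.residue 𝒪[K] c₀)⁻¹ * (IsLocalRing.residue 𝒪[K] (-∏ i, d₀ i))⁻¹) *
            (IsLocalRing.residue 𝒪[K] (d₀ 0) * IsLocalRing.residue 𝒪[K] (t 0) * v.1 ^ 2 + IsLocalRing.residue 𝒪[K] (d₀ 2) * IsLocalRing.residue 𝒪[K] (t 2) * v.2.2 ^ 2)) = 1).card := by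
  have hϖ0 : ϖ ≠ 0 := fun h0 => by rw [h0, map_zero] at hϖ; exact WithZero.coe_ne_zero hϖ.symm
  have hcres : IsLocalRing.residue 𝒪[K] c₀ ≠ 0 := fun h => by
    rw [residue_eq_zero_iff_v_lt_one, hc₀, hc] at h
    exact lt_irrefl _ h
  obtain ⟨A₀, A₀', B, hA₀, hA₀', -, -, hB, hB', hcd, hframe⟩ := exists_residualFrame hvσ hres d d₀ hd₀ hd A hA hA' hdA
  obtain ⟨Y₀, hY₀, hYK, hYres⟩ := exists_leadingMatrix hϖ A A₀ A₀' hA₀ hA₀' s hγA t ht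
  have hYint : IsIntMatrix (Y₀.map (Valued.integer K).subtype) := fun i j => (Valuation.mem_integer_iff _ _).1 (Y₀ i j).2
  have hsub : (((γ : GL (Fin 3) K) : Matrix (Fin 3) (Fin 3) K) - 1) = (ϖ ^ N) • Y₀.map (Valued.integer K).subtype := by
    rw [hYK]; exact conj_diagonal_sub_one_eq_smul A s hγA _ ht
  have hset : {c : {M : Submodule 𝒪[K] (Fin 3 → K) // IsVertex σ ϖ ((StdForm.antidiagonal 3).over K) M} | (latticeGraph σ ϖ ((StdForm.antidiagonal 3).over K)).Adj ⟨stdLattice K 3, 0, isSelfDualLattice_stdLattice_three_of_v hϖ⟩ c ∧ ∃ κ : unitaryGroupOfForm σ ((StdForm.antidiagonal 3).over K), κ ∈ unitaryInt σ ((StdForm.antidiagonal 3).over K) ∧ c = latticeGraphIso σ ϖ ((StdForm.antidiagonal 3).over K) κ ⟨latt (Matrix.diagonal ![(1 : K), 1, ϖ]), 2, isVertexLattice_two_N₁_of_neg hσϖ hϖ⟩ ∧ (∃ a : K, Valued.v a = 1 ∧ Valued.v (((ϖ ^ N)⁻¹ * pairing σ ((StdForm.antidiagonal 3).over K) (((κ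 : GL (Fin 3) K) : Matrix (Fin 3) (Fin 3) K) *ᵥ Pi.single 0 1) ((((γ : GL (Fin 3) K) : Matrix (Fin 3) (Fin 3) K) - 1) *ᵥ (((κ : GL (Fin 3) K) : Matrix (Fin 3) (Fin 3) K) *ᵥ Pi.single 0 1))) - cst * a ^ 2) < 1)} =
      {w | w ∈ (latticeGraph σ ϖ ((StdForm.antidiagonal 3).over K)).neighborSet ⟨stdLattice K 3, 0, isSelfDualLattice_stdLattice_three_of_v hϖ⟩ ∧
        ∃ κ : unitaryGroupOfForm σ ((StdForm.antidiagonal 3).over K), κ ∈ unitaryInt σ ((StdForm.antidiagonal 3).over K) ∧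
          w.1 = mapGL (κ : GL (Fin 3) K) (latt (Matrix.diagonal ![(1 : K), 1, ϖ])) ∧
          ∃ t : 𝒪[K], ((t : K) = (ϖ ^ N)⁻¹ * B₀ σ 3 (((κ : GL (Fin 3) K) : Matrix (Fin 3) (Fin 3) K) *ᵥ (Pi.single 0 1))
              ((((γ : GL (Fin 3) K) : Matrix (Fin 3) (Fin 3) K) - 1) *ᵥ (((κ : GL (Fin 3) K) : Matrix (Fin 3) (Fin 3) K) *ᵥ (Pi.single 0 1)))) ∧ quadraticChar 𝓀[K] ((IsLocalRing.residue 𝒪[K] c₀)⁻¹ * IsLocalRing.residue 𝒪[K] t) = 1} := by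
    ext w
    simp only [Set.mem_setOf_eq, SimpleGraph.mem_neighborSet]
    refine and_congr_right fun _ => exists_congr fun κ => and_congr_right fun hκ => and_congr ⟨fun h => h ▸ rfl, fun h => Subtype.ext h⟩ ?_
    obtain ⟨t₀, ht₀⟩ := exists_integer_pairing_mulVec κ hκ hYint
    rw [← pairing_antidiagonal σ, inv_pow_mul_pairing_sub_one_eq hϖ0 hsub]
    exact exists_unit_class_iff_exists_residue t₀ ht₀ c₀ hc₀ hc
  rw [hset, ncard_neighborSet_root_pred_eq_natCard hσ hvσ hσϖ hϖ hres h2 _ Y₀ hY₀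
    (fun x => quadraticChar 𝓀[K] ((IsLocalRing.residue 𝒪[K] c₀)⁻¹ * x) = 1)
    (fun e u he => by rw [quadraticChar_mul_mul_self_mul _ he]), hYres, ← hB, ← hB']
  have ht1 : IsLocalRing.residue 𝒪[K] (t 1) = 0 := by
    have h1 : (t 1 : K) = 0 := by
      have h := ht 1
      rw [hs1, sub_self] at h
      exact (mul_eq_zero.1 h.symm).resolve_right (pow_ne_zero _ hϖ0)
    have h1' : t 1 = 0 := Subtype.ext h1
    rw [h1', map_zero]
  exact card_sub_one_mul_natCard_params_quadraticChar_eq_card_filter B (inv_ne_zero hcd) hframe (s := fun i => IsLocalRing.residue 𝒪[K] (t i)) ht1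
    ((IsLocalRing.residue 𝒪[K] c₀)⁻¹) (Or.inl rfl)

omit [Valued K ℤᵐ⁰] in
/-- Twisting the class constant by a residual NON-SQUARE flips the character condition: `#{v : iso ∧ χ(ē·X v) = 1} = #{v : iso ∧ χ(X v) = −1}` for `χ(ē) = −1`.
[cite: IrelandRosen1990, Ch. 8 §1] -/
theorem card_filter_quadraticChar_mul_eq_one_eq_of_eq_neg_one {k : Type*} [Field k] [Fintype k] [DecidableEq k] {e : k} (he : quadraticChar k e = -1)
    (Q X : k × k × k → k) :
    (univ.filter fun v : k × k × k => Q v = 0 ∧ quadraticChar k (e * X v) = 1).card =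
      (univ.filter fun v : k × k × k => Q v = 0 ∧ quadraticChar k (X v) = -1).card := by
  refine Finset.card_bij' (fun v _ => v) (fun v _ => v) (fun v hv => ?_) (fun v hv => ?_) (fun _ _ => rfl) (fun _ _ => rfl)
  · rw [Finset.mem_filter] at hv ⊢
    refine ⟨hv.1, hv.2.1, ?_⟩
    have h := hv.2.2
    rw [map_mul, he] at h
    linarith [h]
  · rw [Finset.mem_filter] at hv ⊢
    refine ⟨hv.1, hv.2.1, ?_⟩
    rw [map_mul, he, hv.2.2]
    norm_num

end Literature.NumberTheory.Rogawski1990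

end
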